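import Mathlib
import Summits.Ventures.PercRepro2.TablePackage2

/-! # Packages certified by their tables, III: linear certificates
(seat mine-b, cell pub-perc-repro2; MINE-B.md §26)

Two kernel computations of the table route are quadratic in the table — the red-up table must be
`Nodup` and must cover `{r ≥ 1, b ≥ 2}` — and a 10-edge network can have 900 red-up entries.  Both
become linear through the bitmask `SP.encode` of a configuration: a table listed in strictly
increasing key-bitmask order has `Nodup` keys (`nodup_of_isChain_map`, a `List.IsChain` check), and
`Nodup` keys that all lie in the domain cover it as soon as their number is at least the domain's
cardinality (`cover_of_card`, a counting argument on `Finset.univ.filter`). -/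

namespace Summit.Ventures.PercRepro2.V2Closure

/-- the number of free edges of a network -/
def SP.nfree : SP → ℕ
  | .free => 1
  | .pin => 0
  | .absent => 0
  | .ser s t => s.nfree + t.nfree
  | .par s t => s.nfree + t.nfree

/-- the bitmask of a configuration: the blue free edges as set bits, the first factor in the low bits -/
def SP.encode : ∀ s : SP, s.Conf → ℕ
  | .free => fun (c : Bool) => if c then 1 else 0
  | .pin => fun _ => 0
  | .absent => fun _ => 0
  | .ser s t => fun p => s.encode p.1 + 2 ^ s.nfree * t.encode p.2
  | .par s t => fun p => s.encode p.1 + 2 ^ s.nfree * t.encode p.2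

end Summit.Ventures.PercRepro2.V2Closure

namespace Summit.Ventures.PercRepro2.UHClosure

/-- **a list whose images under a map are strictly increasing is `Nodup`** -/
theorem nodup_of_isChain_map {α : Type*} (l : List α) (enc : α → ℕ)
    (h : (l.map enc).IsChain (· < ·)) : l.Nodup :=
  List.Nodup.of_map enc ((List.isChain_iff_pairwise.1 h).imp fun hab => ne_of_lt hab)

/-- **`Nodup` keys inside a decidable predicate cover it once they are at least as many as the
predicate's elements** (counting on `Finset.univ.filter`) -/
theorem cover_of_card {X : Type*} [Fintype X] [DecidableEq X] (P : X → Prop) [DecidablePred P]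
    (keys : List X) (hnd : keys.Nodup) (hin : ∀ k ∈ keys, P k)
    (hcard : (Finset.univ.filter P).card ≤ keys.length) : ∀ x, P x → x ∈ keys := by
  have hsub : keys.toFinset ⊆ Finset.univ.filter P := by
    intro k hk
    rw [List.mem_toFinset] at hk
    exact Finset.mem_filter.2 ⟨Finset.mem_univ _, hin k hk⟩
  have hcard' : (Finset.univ.filter P).card ≤ keys.toFinset.card := by
    rw [List.toFinset_card_of_nodup hnd]; exact hcard
  have heq := Finset.eq_of_subset_of_card_le hsub hcard'
  intro x hx
  have hmem : x ∈ keys.toFinset := by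
    rw [heq]; exact Finset.mem_filter.2 ⟨Finset.mem_univ _, hx⟩
  exact List.mem_toFinset.1 hmem

/-- **the keys of a key–value table cover a predicate**, from linear facts: the keys are listed in
strictly increasing bitmask order, every key satisfies the predicate, and the table is at least as
long as the predicate's set -/
theorem table_covers_of_card {X : Type*} [Fintype X] [DecidableEq X] (P : X → Prop) [DecidablePred P]
    (T : List (X × X)) (enc : X → ℕ) (hsorted : (T.map (fun e => enc e.1)).IsChain (· < ·))
    (hin : ∀ e ∈ T, P e.1) (hcard : (Finset.univ.filter P).card ≤ T.length) :
    ∀ x, P x → ∃ e ∈ T, e.1 = x := by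
  intro x hx
  have hnd : (T.map Prod.fst).Nodup := by
    apply nodup_of_isChain_map (T.map Prod.fst) enc
    rw [List.map_map]; exact hsorted
  have hin' : ∀ k ∈ T.map Prod.fst, P k := by
    intro k hk
    obtain ⟨e, he, rfl⟩ := List.mem_map.1 hk
    exact hin e he
  have hlen : (Finset.univ.filter P).card ≤ (T.map Prod.fst).length := by
    rw [List.length_map]; exact hcard
  obtain ⟨e, he, hek⟩ := List.mem_map.1 (cover_of_card P (T.map Prod.fst) hnd hin' hlen x hx)
  exact ⟨e, he, hek⟩

end Summit.Ventures.PercRepro2.UHClosure
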